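import Summits.BirchSwinnertonDyer.Rank1Residual.Additive.X4RankOneKimCorner
import HarnessLib

/-!
# X4 ∧ `r_an = 1`: the rank-one RESIDUE NAMED EXACTLY — granted Kim's `∂`-clause and ONE non-zero
# prime-level Kurihara number, `BSD(E,p)` at a rank-one pair IS an identity between Kurihara-number
# invariants and `#Ш_an`: `∂^{(1)}(δ̃) = ord_p #Ш_an + ∂^{(∞)}(δ̃)`; with Kim's Conjecture 1.10,
# `∂^{(1)}(δ̃) = ord_p #Ш_an + ord_p ∏_ℓ c_ℓ` (cell `b2b-bsdres`, team n1011, sub-target T-a2r1c — FILE 4 of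
# the T-a2r1 lineage; the rank-one twin of cc-typer-1's `X4.bsdp_iff_eq_tamagawa_of_rankZero_witness` and of
# additive-p4's `X4.bsdp_iff_kimTamagawaDefectAt_of_kimFacts_of_five_le`)

HONEST FRAMING (cell `b2b-bsdres`, run/shared/lean/b2b/bsd-rank1-residual/, verbatim in every
file): the goal of the cell is to DELETE the COMBINATION-SHAPED residual classes of the
Birch–Swinnerton-Dyer formula for ALL analytic-rank `≤ 1` elliptic curves over `ℚ` — "full BSD
formula for every rank `≤ 1` curve in class `C`" assembled STRICTLY from published theorems — so
that the rank-`≤ 1` remainder becomes exactly the CONSTRUCTION-SHAPED classes, which are TYPED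
(missing-input `Prop`s), NOT attempted. This is not "finishing BSD". Team n1011: prove what is
provable now; shrink each hard class to its core with data; no claim beyond stated classes;
research routes; census output = EVIDENCE / conjecture items, never a Literature fact; RESIDUAL-MAP
marks change only by signed lines. X4 stays CONSTRUCTION-SHAPED; §I O7 stays OPEN; nothing here is
booked. Theorems only (NO definition, NO Literature fact, NO `_holds`); every published input and
every conjecture is an explicit hypothesis; `#print axioms` standard.

COVERAGE (stated first, referee 1 proviso): per pair, `W/ℚ` globally minimal, ANY prime `p`, ANY
reduction at `p`, analytic rank `1`, `ρ̄_{E,p}` onto with the tower, a modular parametrisation datum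
`D` with `p ∤ c_D` and the period transfer, `#Ш_an = q`. HYPOTHESES, all explicit: the `∂`-clause
`KimRankOnePartialAt W p` (`hK`; at `p ≥ 5` = Kim's THEOREM 1.8 (6) — harvest-2's Literature fact E73,
ONE application of their one-liner; at `p = 3` OUR conjecture `X4SharpThreeKimRankOnePartial` / [K25]
announced), the FINITENESS `∂^{(1)}(δ̃) ≠ ∞` (`hne`: SOME cyclic prime-level Kurihara number is
non-zero — a per-pair CERTIFICATE, EVIDENCE; its existence in rank one at an additive `p` is announced
by NO source, Kim 2025 Thm. 1.2 (rk1+ε) needs `p² ∤ N`), and in §2 Kim's Conjecture 1.10 at the pair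
(p12's `X4.KimTamagawaDefectAt W p D.f`, BOTH halves). Nothing is asserted about any curve without them.

## What (rank `0` vs rank `1`)

In analytic rank `0`, `∂^{(0)}(δ̃) = ord_p(L(E,1)/Ω)` is an ANALYTIC quantity, so clause (6) makes
`BSD(E,p)` EQUIVALENT to a statement about `∂^{(∞)}` alone — Kim's Conjecture 1.10 at the pair
(cc-typer-1 `X4.bsdp_iff_eq_tamagawa_of_rankZero_witness`; additive-p4 at `p ≥ 5`). In analytic rank
`1`, `δ̃_1 = L(E,1)/Ω = 0` and the first invariant is `∂^{(1)}(δ̃) = min_ℓ ord_p δ̃_ℓ` over the cyclic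
Kolyvagin PRIMES — an invariant of the modular symbols of `f_E` with NO classical `L`-value reading
(Kim's "higher Gross–Zagier" philosophy, arXiv:2203.12161 Rem. 2.4: "`∂^{(i)}` plays the role of the
`i`-th Taylor coefficient"). So the rank-one residue is NOT Conjecture 1.10 alone:

* §1 `missingPPartAt_iff_exists_partial_eq_of_kimRankOnePartialAt` — granted `hK` and `∂^{(1)} ≠ ∞`:
  **`Typed.MissingPPartAt W p ↔ ∃ m : ℕ, ord_p #Ш_an = m ∧ m + ∂^{(∞)}(δ̃) = ∂^{(1)}(δ̃)`**; the LOWER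
  half (`missingLowerBoundAt_of_partial_le_…`, `partial_le_of_missingLowerBoundAt_…`: `m + ∂^{(∞)} ≤ ∂^{(1)}`
  for `m` around `ord_p #Ш_an`), all from `padicValNat_shaOrder_add_partialInfty_eq_of_kimRankOnePartialAt`
  (`ord_p #Ш + ∂^{(∞)} = ∂^{(1)}`, i.e. `hK` read with `Ш` finite). The UPPER half from a certificate is
  FILE 3a.
* §2 with Conjecture 1.10 at the pair (`X4.KimTamagawaDefectAt W p D.f`, i.e. `∂^{(∞)} = ord_p ∏c`):
  **`Typed.MissingPPartAt W p ↔ ∃ m : ℕ, ord_p #Ш_an = m ∧ ((m + ord_p ∏c : ℕ) : ℕ∞) = ∂^{(1)}(δ̃)`** —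
  the O7 ∩ X4 ∧ surj rank-one residue at the pair is the IDENTITY `∂^{(1)}(δ̃) = ord_p #Ш_an + ord_p ∏_ℓ c_ℓ`
  (the `≤` of which ONE certificate at level `ord_p ∏c + ord_p #Ш_an + 1` proves — FILE 3a — and the
  `≥` of which is a statement about ALL cyclic prime-level Kurihara numbers, the LOWER side).
* §3 the `BSD(E,p)` form (`hGZK`, `hmod`) and the `p = 3` class form on O7 ∩ X4@3.

Numerically (EVIDENCE, cc-eng-1 `class-closure/O7/pairs.tsv`): X4 ∧ surj ∧ `r = 1` residue pairs at
`p ≥ 5` = 835 — there §1 is a statement modulo E73 (PUBLISHED) + the certificate, §2 additionally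
modulo Conj. 1.10; at `p = 3` (10 105 surj pairs) modulo our conjecture.

References: C.-H. Kim, Amer. J. Math. 148 (2026) = arXiv:2203.12159v4 [Kim2022StructureSelmer] Thm.
1.9 (6), §1.5.1, Conj. 1.10 (PDF p. 8); C.-H. Kim, arXiv:2203.12161 (2022) Rem. 2.4 (reading only);
R. L. Miller, LMS J. Comput. Math. 14 (2011) [Miller2011LMS] Def. 1.1; cell files cells/n1011/OWNERS.md
(T-a2r1c), cells/n1011/skel/T-a2r1c.md.
-/

noncomputable section

open scoped Classical MatrixGroups ModularForm

open CongruenceSubgroup WeierstrassCurve Literature.NumberTheory.EllipticCurves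
  Literature.NumberTheory.EllipticCurves.ModularForms
  Literature.NumberTheory.EllipticCurves.Rank1Residual
  Literature.NumberTheory.EllipticCurves.Rank1Residual.Typed

namespace Summit.BirchSwinnertonDyer.Rank1Residual.Additive

/-! ## §1 The residue as an identity of Kurihara invariants (granted the `∂`-clause) -/

section Residue

variable (W : WeierstrassCurve ℚ) [W.IsElliptic] [W.IsGloballyMinimal] (p : ℕ) [Fact p.Prime]

/-- **`ord_p #Ш(E/ℚ) + ∂^{(∞)}(δ̃) = ∂^{(1)}(δ̃)`** (in `ℕ∞`): the `∂`-clause `KimRankOnePartialAt W p`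
read with `Ш` finite (`ord_p #Ш = ord_p #Ш(p)`), under the T-a2 binder block and `∂^{(1)} ≠ ∞`.
[cite: Kim2022StructureSelmer, Thm. 1.9 (6) and §1.5.1 (PDF pp. 7–8)] -/
theorem padicValNat_shaOrder_add_partialInfty_eq_of_kimRankOnePartialAt (hK : KimRankOnePartialAt W p)
    (hsurj : W.HasSurjectiveModNGaloisRep p)
    (htower : ∀ n : ℕ, W.HasSurjectiveModNGaloisRep (p ^ n : ℕ)) (hL : W.entireLFunction 1 = 0)
    (hr : W.analyticRank = 1) (hfin : Finite W.sha)
    {N : ℕ} [NeZero N] (D : ModularParametrizationData W N) (hc : ¬ (p : ℤ) ∣ D.maninConstant)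
    (hper : ∃ u : ℚ, ‖(u : ℚ_[p])‖ = 1 ∧ W.realPeriodRat = u * plusPeriod D.f)
    (hne : kuriharaPartial W p D.f 1 ≠ ⊤) :
    (padicValNat p W.shaOrder : ℕ∞) + kuriharaPartialInfty W p D.f = kuriharaPartial W p D.f 1 := by
  haveI : Finite W.sha := hfin
  have h := hK hsurj htower hL hr hfin D hc hper hne
  rw [padicValNat_card_addPrimaryComponent p] at h
  unfold WeierstrassCurve.shaOrder
  exact h

omit [W.IsElliptic] [Fact p.Prime] in
/-- `∂^{(∞)}(δ̃) ≠ ∞` once `∂^{(1)}(δ̃) ≠ ∞` (`∂^{(∞)} ≤ ∂^{(1)}`). Bookkeeping.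
[cite: Kim2022StructureSelmer, §1.5.1 (PDF p. 7)] -/
theorem kuriharaPartialInfty_ne_top_of_kuriharaPartial_one_ne_top {N : ℕ} (f : CuspForm (Gamma0 N) 2)
    (hne : kuriharaPartial W p f 1 ≠ ⊤) : kuriharaPartialInfty W p f ≠ ⊤ :=
  ne_top_of_le_ne_top hne (kuriharaPartialInfty_le W p f 1)

/-- **THE RANK-ONE RESIDUE, NAMED**: granted the `∂`-clause and `∂^{(1)}(δ̃) ≠ ∞`, the missing
`p`-part output at the pair holds IFF `ord_p #Ш_an` is a natural number `m` with
`m + ∂^{(∞)}(δ̃) = ∂^{(1)}(δ̃)` — `BSD(E,p)` in rank one is an identity between the two Kurihara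
invariants and the analytic order of `Ш`. Per pair; ANY reduction; nothing booked.
[cite: Kim2022StructureSelmer, Thm. 1.9 (6) and §1.5.1 (PDF pp. 7–8)] [cite: Miller2011LMS, Def. 1.1] -/
theorem missingPPartAt_iff_exists_partial_eq_of_kimRankOnePartialAt (hK : KimRankOnePartialAt W p)
    (hsurj : W.HasSurjectiveModNGaloisRep p)
    (htower : ∀ n : ℕ, W.HasSurjectiveModNGaloisRep (p ^ n : ℕ)) (hL : W.entireLFunction 1 = 0)
    (hr : W.analyticRank = 1) (hfin : Finite W.sha)
    {N : ℕ} [NeZero N] (D : ModularParametrizationData W N) (hc : ¬ (p : ℤ) ∣ D.maninConstant)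
    (hper : ∃ u : ℚ, ‖(u : ℚ_[p])‖ = 1 ∧ W.realPeriodRat = u * plusPeriod D.f)
    (hne : kuriharaPartial W p D.f 1 ≠ ⊤) {q : ℚ} (hq : shaAn W = (q : ℂ)) :
    MissingPPartAt W p ↔
      ∃ m : ℕ, padicValRat p q = m ∧
        (m : ℕ∞) + kuriharaPartialInfty W p D.f = kuriharaPartial W p D.f 1 := by
  have hid := padicValNat_shaOrder_add_partialInfty_eq_of_kimRankOnePartialAt W p hK hsurj htower hL hr
    hfin D hc hper hne
  have hinf : kuriharaPartialInfty W p D.f ≠ ⊤ :=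
    kuriharaPartialInfty_ne_top_of_kuriharaPartial_one_ne_top W p D.f hne
  constructor
  · rintro ⟨q', hq', hv⟩
    have hqq : q' = q := by exact_mod_cast hq'.symm.trans hq
    subst hqq
    exact ⟨padicValNat p W.shaOrder, hv, hid⟩
  · rintro ⟨m, hm, hmid⟩
    have hmeq : (m : ℕ∞) = (padicValNat p W.shaOrder : ℕ∞) :=
      WithTop.add_right_cancel hinf (hmid.trans hid.symm)
    have hmn : m = padicValNat p W.shaOrder := by exact_mod_cast hmeq
    exact ⟨q, hq, by rw [hm, hmn]⟩

/-- **The LOWER half from the `≥` side of the identity**: granted the `∂`-clause and `∂^{(1)} ≠ ∞`, if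
`m + ∂^{(∞)}(δ̃) ≤ ∂^{(1)}(δ̃)` for a natural number `m ≥ ord_p #Ш_an` then `Typed.MissingLowerBoundAt W p`.
(The `≥` side is a statement about ALL cyclic prime-level Kurihara numbers — no single certificate
proves it.) [cite: Kim2022StructureSelmer, Thm. 1.9 (6) and §1.5.1 (PDF pp. 7–8)] [cite: Miller2011LMS, Def. 1.1] -/
theorem missingLowerBoundAt_of_partial_le_of_kimRankOnePartialAt (hK : KimRankOnePartialAt W p)
    (hsurj : W.HasSurjectiveModNGaloisRep p)
    (htower : ∀ n : ℕ, W.HasSurjectiveModNGaloisRep (p ^ n : ℕ)) (hL : W.entireLFunction 1 = 0)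
    (hr : W.analyticRank = 1) (hfin : Finite W.sha)
    {N : ℕ} [NeZero N] (D : ModularParametrizationData W N) (hc : ¬ (p : ℤ) ∣ D.maninConstant)
    (hper : ∃ u : ℚ, ‖(u : ℚ_[p])‖ = 1 ∧ W.realPeriodRat = u * plusPeriod D.f)
    (hne : kuriharaPartial W p D.f 1 ≠ ⊤) {q : ℚ} (hq : shaAn W = (q : ℂ)) (m : ℕ)
    (hm : padicValRat p q ≤ m)
    (hle : (m : ℕ∞) + kuriharaPartialInfty W p D.f ≤ kuriharaPartial W p D.f 1) :
    MissingLowerBoundAt W p := by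
  have hid := padicValNat_shaOrder_add_partialInfty_eq_of_kimRankOnePartialAt W p hK hsurj htower hL hr
    hfin D hc hper hne
  have hinf : kuriharaPartialInfty W p D.f ≠ ⊤ :=
    kuriharaPartialInfty_ne_top_of_kuriharaPartial_one_ne_top W p D.f hne
  obtain ⟨d, hd⟩ := ENat.ne_top_iff_exists.mp hinf
  rw [← hd] at hid hle
  have h1 : ((m + d : ℕ) : ℕ∞) ≤ ((padicValNat p W.shaOrder + d : ℕ) : ℕ∞) := by
    push_cast
    rw [hid]
    exact hle
  have h2 : m + d ≤ padicValNat p W.shaOrder + d := by exact_mod_cast h1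
  refine ⟨q, hq, le_trans hm ?_⟩
  exact_mod_cast (by omega : m ≤ padicValNat p W.shaOrder)

/-- Conversely the LOWER half gives `m + ∂^{(∞)} ≤ ∂^{(1)}` for every natural number `m ≤ ord_p #Ш_an`.
[cite: Kim2022StructureSelmer, Thm. 1.9 (6) and §1.5.1 (PDF pp. 7–8)] [cite: Miller2011LMS, Def. 1.1] -/
theorem partial_le_of_missingLowerBoundAt_of_kimRankOnePartialAt (hK : KimRankOnePartialAt W p)
    (hsurj : W.HasSurjectiveModNGaloisRep p)
    (htower : ∀ n : ℕ, W.HasSurjectiveModNGaloisRep (p ^ n : ℕ)) (hL : W.entireLFunction 1 = 0)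
    (hr : W.analyticRank = 1) (hfin : Finite W.sha)
    {N : ℕ} [NeZero N] (D : ModularParametrizationData W N) (hc : ¬ (p : ℤ) ∣ D.maninConstant)
    (hper : ∃ u : ℚ, ‖(u : ℚ_[p])‖ = 1 ∧ W.realPeriodRat = u * plusPeriod D.f)
    (hne : kuriharaPartial W p D.f 1 ≠ ⊤) {q : ℚ} (hq : shaAn W = (q : ℂ))
    (hlow : MissingLowerBoundAt W p) (m : ℕ) (hm : (m : ℤ) ≤ padicValRat p q) :
    (m : ℕ∞) + kuriharaPartialInfty W p D.f ≤ kuriharaPartial W p D.f 1 := by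
  have hid := padicValNat_shaOrder_add_partialInfty_eq_of_kimRankOnePartialAt W p hK hsurj htower hL hr
    hfin D hc hper hne
  obtain ⟨q', hq', hv⟩ := hlow
  have hqq : q' = q := by exact_mod_cast hq'.symm.trans hq
  subst hqq
  have hmle : m ≤ padicValNat p W.shaOrder := by exact_mod_cast hm.trans hv
  calc (m : ℕ∞) + kuriharaPartialInfty W p D.f
      ≤ (padicValNat p W.shaOrder : ℕ∞) + kuriharaPartialInfty W p D.f :=
        add_le_add (by exact_mod_cast hmle) le_rfl
    _ = kuriharaPartial W p D.f 1 := hid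

end Residue

/-! ## §2 With Kim's Conjecture 1.10 at the pair: `∂^{(1)}(δ̃) = ord_p #Ш_an + ord_p ∏_ℓ c_ℓ` -/

section WithTamagawa

variable (W : WeierstrassCurve ℚ) [W.IsElliptic] [W.IsGloballyMinimal] (p : ℕ) [Fact p.Prime]

/-- **THE RANK-ONE RESIDUE under Conjecture 1.10**: granted the `∂`-clause (`hK`), `∂^{(1)} ≠ ∞`
(`hne`) and Kim's Conjecture 1.10 at the pair (`hT : ∂^{(∞)}(δ̃) = ord_p ∏c`, p12's
`X4.KimTamagawaDefectAt`), the missing `p`-part output holds IFF `ord_p #Ш_an` is a natural number `m`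
with `∂^{(1)}(δ̃) = m + ord_p ∏_ℓ c_ℓ`. So on O7 ∩ X4 ∧ surj the rank-one residue at a pair is the
identity `∂^{(1)}(δ̃) = ord_p #Ш_an + ord_p ∏c`: its `≤` is ONE certificate (FILE 3a), its `≥` is the
LOWER side. Per pair; ANY reduction; all three inputs explicit; nothing booked.
[cite: Kim2022StructureSelmer, Thm. 1.9 (6), §1.5.1 and Conj. 1.10 (PDF pp. 7–8)] [cite: Miller2011LMS, Def. 1.1] -/
theorem missingPPartAt_iff_exists_partial_eq_of_kimRankOnePartialAt_of_tamagawaDefect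
    (hK : KimRankOnePartialAt W p) (hsurj : W.HasSurjectiveModNGaloisRep p)
    (htower : ∀ n : ℕ, W.HasSurjectiveModNGaloisRep (p ^ n : ℕ)) (hL : W.entireLFunction 1 = 0)
    (hr : W.analyticRank = 1) (hfin : Finite W.sha)
    {N : ℕ} [NeZero N] (D : ModularParametrizationData W N) (hc : ¬ (p : ℤ) ∣ D.maninConstant)
    (hper : ∃ u : ℚ, ‖(u : ℚ_[p])‖ = 1 ∧ W.realPeriodRat = u * plusPeriod D.f)
    (hne : kuriharaPartial W p D.f 1 ≠ ⊤) (hT : X4.KimTamagawaDefectAt W p D.f)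
    {q : ℚ} (hq : shaAn W = (q : ℂ)) :
    MissingPPartAt W p ↔
      ∃ m : ℕ, padicValRat p q = m ∧
        ((m + padicValNat p W.tamagawaProduct : ℕ) : ℕ∞) = kuriharaPartial W p D.f 1 := by
  rw [missingPPartAt_iff_exists_partial_eq_of_kimRankOnePartialAt W p hK hsurj htower hL hr hfin D hc
    hper hne hq]
  unfold X4.KimTamagawaDefectAt at hT
  constructor
  · rintro ⟨m, hm, hid⟩
    refine ⟨m, hm, ?_⟩
    rw [← hid, hT]
    push_cast
    rfl
  · rintro ⟨m, hm, hid⟩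
    refine ⟨m, hm, ?_⟩
    rw [← hid, hT]
    push_cast
    rfl

/-- **`BSD(E,p)` form** (Gross–Zagier–Kolyvagin `hGZK`, modularity `hmod`): granted the `∂`-clause,
`∂^{(1)} ≠ ∞` and Conjecture 1.10 at the pair,
`BSD(E,p) ↔ ∃ m : ℕ, ord_p #Ш_an = m ∧ ∂^{(1)}(δ̃) = m + ord_p ∏c`. Per pair; nothing booked.
[cite: Kim2022StructureSelmer, Thm. 1.9 (6), §1.5.1 and Conj. 1.10 (PDF pp. 7–8)]
[cite: Miller2011LMS, §1 and Def. 1.1] -/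
theorem bsdp_iff_exists_partial_eq_of_kimRankOnePartialAt_of_tamagawaDefect
    (hK : KimRankOnePartialAt W p) (hGZK : rank_eq_analyticRank_of_analyticRank_le_one)
    (hmod : hasEntireLFunction_rat) (hsurj : W.HasSurjectiveModNGaloisRep p)
    (htower : ∀ n : ℕ, W.HasSurjectiveModNGaloisRep (p ^ n : ℕ)) (hr : W.analyticRank = 1)
    {N : ℕ} [NeZero N] (D : ModularParametrizationData W N) (hc : ¬ (p : ℤ) ∣ D.maninConstant)
    (hper : ∃ u : ℚ, ‖(u : ℚ_[p])‖ = 1 ∧ W.realPeriodRat = u * plusPeriod D.f)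
    (hne : kuriharaPartial W p D.f 1 ≠ ⊤) (hT : X4.KimTamagawaDefectAt W p D.f)
    {q : ℚ} (hq : shaAn W = (q : ℂ)) :
    BSDp W p ↔
      ∃ m : ℕ, padicValRat p q = m ∧
        ((m + padicValNat p W.tamagawaProduct : ℕ) : ℕ∞) = kuriharaPartial W p D.f 1 := by
  have hr1 : W.analyticRank ≤ 1 := by rw [hr]
  have hL : W.entireLFunction 1 = 0 := by
    by_contra hne'
    have h0 := (W.analyticRank_eq_zero_iff_holds (hmod W)).mpr hne'
    omega
  have hfin : Finite W.sha := (hGZK W hr1).2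
  haveI : Finite W.sha := hfin
  rw [← missingPPartAt_iff_exists_partial_eq_of_kimRankOnePartialAt_of_tamagawaDefect W p hK hsurj
    htower hL hr hfin D hc hper hne hT hq]
  exact ⟨fun h => missingPPartAt_of_bsdp W p h, fun h => bsdp_of_missingPPartAt W p hGZK hr1 h⟩

end WithTamagawa

/-! ## §3 The `p = 3` class form on O7 ∩ X4@3 (modulo our conjecture and Conjecture 1.10) -/

section Three

variable (W : WeierstrassCurve ℚ) [W.IsElliptic] [W.IsGloballyMinimal]

/-- **O7 ∩ X4@3, rank one, surjective towered row:
`BSD(E,3) ↔ ∃ m, ord₃ #Ш_an = m ∧ ∂^{(1)}(δ̃) = m + ord₃ ∏c`**, MODULO `X4SharpThreeKimRankOnePartial` (`h3`),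
Kim's Conjecture 1.10 at the pair (`hT`) and ONE non-zero cyclic prime-level Kurihara number (`hne`,
the certificate); tower by the `j`-witness / surj(9) certificate. Per pair; NOT a class theorem;
nothing booked. [cite: Kim2022StructureSelmer, Thm. 1.9 (6), §1.5.1 and Conj. 1.10 (PDF pp. 7–8)]
[cite: SerreAbelianLadic1968, Ch. IV §3.4, Lemma 3 (IV-23)] [cite: Miller2011LMS, Def. 1.1] -/
theorem X4RankOne.bsdp_three_iff_exists_partial_eq_of_partial_of_tamagawaDefect
    (h3 : X4SharpThreeKimRankOnePartial) (hGZK : rank_eq_analyticRank_of_analyticRank_le_one)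
    (hmod : hasEntireLFunction_rat) (hX : ClassX4 W 3) (hsurj : Surj W 3)
    (hcert : (∃ q : ℕ, q.Prime ∧ q ≠ 3 ∧ padicValRat q W.j < 0 ∧ ¬ (3 : ℤ) ∣ padicValRat q W.j) ∨
      W.HasSurjectiveModNGaloisRep 9)
    (hr : W.analyticRank = 1)
    {N : ℕ} [NeZero N] (D : ModularParametrizationData W N) (hc : ¬ (3 : ℤ) ∣ D.maninConstant)
    (hper : ∃ u : ℚ, ‖(u : ℚ_[3])‖ = 1 ∧ W.realPeriodRat = u * plusPeriod D.f)
    (hne : kuriharaPartial W 3 D.f 1 ≠ ⊤) (hT : X4.KimTamagawaDefectAt W 3 D.f)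
    {q : ℚ} (hq : shaAn W = (q : ℂ)) :
    BSDp W 3 ↔
      ∃ m : ℕ, padicValRat 3 q = m ∧
        ((m + padicValNat 3 W.tamagawaProduct : ℕ) : ℕ∞) = kuriharaPartial W 3 D.f 1 :=
  bsdp_iff_exists_partial_eq_of_kimRankOnePartialAt_of_tamagawaDefect W 3
    (kimRankOnePartialAt_three_of_classX4 W h3 hX) hGZK hmod hsurj
    (towerSurj_three_of_surj_of_jWitness_or_nine W hsurj hcert) hr D (by exact_mod_cast hc) hper hne hT hq

end Three

end Summit.BirchSwinnertonDyer.Rank1Residual.Additive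

end
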